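import Mathlib
import HarnessLib
import Summits.RiemannHypothesis.RiemannHypothesis.Theorems.ScrewManifestCertTopBlock
import Summits.RiemannHypothesis.RiemannHypothesis.Theorems.IntegerScrewTailSoundB
import Summits.RiemannHypothesis.RiemannHypothesis.Theorems.IntegerScrewTailCells
import Summits.RiemannHypothesis.RiemannHypothesis.Theorems.IntegerScrewTopBlockNegHead
import Summits.RiemannHypothesis.RiemannHypothesis.Theses.ScrewNyquistFloor

/-!
# The top-block pairing inequality of the SCREW column: `TopBlockPairingNeg 31`
Kernel import of sos-theory's RH-free numerical input
`Manifest.TopBlockPairingNeg 31 : ∀ N ≥ 31, Σ_e tbC e · zetaScrew (tbD N e) < 0` (column SCREW, engine A,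
director-rh I l.7143/7240), design `D16` (`d16 = List.ofFn (tbA, tbB, tbK)` by `decide`).
* TAIL `N ≥ 129` (this file, assembly): the validated cell chain `tailCells` (kernel certificates
  `tailCellsA_pass`, `tailCellsB_pass`, `tailCells_reach`, `tailLast_pass` of `IntegerScrewTailCells`) through
  `cellCheck_sound` / `lastCheck_sound` gives `tail_neg_real` (`D(N) < 0` for real `N > 128`) and
  `topPairingSum_neg_129`.
* HEAD `31 ≤ N ≤ 128`: `topPairing_neg_of_le_128` (`IntegerScrewTopBlockNegHead`, the tree's certified
  `S_128` entry table).
* LAST CELL `N ≥ 20395`: `lastCheck_sound` (sign argument; this file).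
* GLUE: `topPairing_neg` (`∀ N ≥ 31`), `topBlockPairingNeg_31 : Manifest.TopBlockPairingNeg 31`, and the CLOSER
  `topBlockNeg31 : Theses.ScrewNyquistFloor.TopBlockNeg31` of crux `stmt-RiemannHypothesis-20030` (route `ScrewNyquistFloor`).
Nothing here bears on the truth of RH. (Build re-enqueue re-land 2026-08-26 by sos-filer-1 g2: hub olean 09:08Z STALE vs rebuilt import `IntegerScrewTopBlockNegHead` 12:50Z; every declaration byte-identical to p425557, sos-eng-1 gen11.)
-/

set_option autoImplicit false
set_option linter.dupNamespace false
noncomputable section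
open scoped Topology
open Real Filter Set

namespace Summit.RiemannHypothesis.RiemannHypothesis.Theorems.IntegerScrew.TopBlockNeg
/-! ### The last cell `N ≥ N_top`: soundness of `lastCheck` -/
open Literature.Analysis.ValidatedNumerics Literature.Analysis.ValidatedNumerics.Numerics
open Summit.RiemannHypothesis.RiemannHypothesis.Theorems.IntegerScrew
open Literature.NumberTheory.LFunctions
open Finset

set_option maxHeartbeats 400000 in
/-- **Per-edge inequality for the last cell.** [folklore] -/
theorem lastEdge_le {a b : ℕ} (k : ℤ) {Ntop : ℕ} (hab : a < b) (hb15 : b ≤ 15) (hNt : 128 ≤ Ntop)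
    {N : ℝ} (hN : (Ntop : ℝ) ≤ N) :
    (k : ℝ) * edgeH a b N ≤ Real.log N / 2 * ((k : ℝ) * (N * edgeU a b N)) + rbVal a b k Ntop := by
  have hab' : (a : ℝ) < b := by exact_mod_cast hab
  have hb15' : (b : ℝ) ≤ 15 := by exact_mod_cast hb15
  have hNt' : (128 : ℝ) ≤ Ntop := by exact_mod_cast hNt
  have ha0 : (0 : ℝ) ≤ a := Nat.cast_nonneg a
  have hb0 : (0 : ℝ) ≤ b := Nat.cast_nonneg b
  have hNpos : 0 < N := by linarith
  have hbN : (b : ℝ) < N := by linarith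
  obtain ⟨hu0, _⟩ := edgeU_pos_lt hab (N := N) (by linarith)
  obtain ⟨ulo, uhi⟩ := edgeU_bounds hab hbN
  have hl1 : (1 : ℝ) ≤ (b : ℝ) - a := by
    have : a + 1 ≤ b := hab
    have : ((a : ℝ) + 1 ≤ b) := by exact_mod_cast this
    linarith
  have hl0 : (0 : ℝ) < (b : ℝ) - a := by linarith
  have hNb : 0 < N - b := by linarith
  have hNtb : (0 : ℝ) < (Ntop : ℝ) - b := by linarith
  have hu_half : edgeU a b N ≤ 1 / 2 := by
    have : ((b : ℝ) - a) / (N - b) ≤ 1 / 2 := by rw [div_le_iff₀ hNb]; linarith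
    linarith
  -- λ = N u and its bounds
  have hlam_pos : 0 < N * edgeU a b N := mul_pos hNpos hu0
  have hlam_ge : (b : ℝ) - a ≤ N * edgeU a b N := by
    have h1 : (b : ℝ) - a ≤ N * (((b : ℝ) - a) / (N - a)) := by
      rw [mul_div_assoc', le_div_iff₀ (by linarith)]; nlinarith
    exact le_trans h1 (mul_le_mul_of_nonneg_left ulo hNpos.le)
  have hkey : 0 ≤ ((b : ℝ) - a) * b * (N - Ntop) := mul_nonneg (mul_nonneg hl0.le hb0) (by linarith)
  have hu_max : edgeU a b N ≤ ((b : ℝ) - a) / ((Ntop : ℝ) - b) :=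
    le_trans uhi (div_le_div_of_nonneg_left hl0.le hNtb (by linarith))
  have hlam_le : N * edgeU a b N ≤ ((b : ℝ) - a) * Ntop / ((Ntop : ℝ) - b) := by
    have h1 : N * edgeU a b N ≤ N * (((b : ℝ) - a) / (N - b)) := mul_le_mul_of_nonneg_left uhi hNpos.le
    have h2 : N * (((b : ℝ) - a) / (N - b)) ≤ ((b : ℝ) - a) * Ntop / ((Ntop : ℝ) - b) := by
      rw [mul_div_assoc', div_le_div_iff₀ hNb hNtb]; nlinarith
    linarith
  have hlamMax0 : 0 ≤ ((b : ℝ) - a) * Ntop / ((Ntop : ℝ) - b) := le_trans hlam_pos.le hlam_le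
  have huMax0 : 0 ≤ ((b : ℝ) - a) / ((Ntop : ℝ) - b) := le_trans hu0.le hu_max
  -- decomposition
  obtain ⟨rlo, rhi⟩ := zetaScrew_smallArg_bounds hu0 hu_half
  have hmain := main_decomp hNpos hu0 (u := edgeU a b N)
  have hedge : edgeH a b N = N * zetaScrewMain (edgeU a b N)
      + N * (zetaScrew (edgeU a b N) - zetaScrewMain (edgeU a b N)) := by
    unfold edgeH; ring
  -- f bounds (antitone on [1, ∞))
  have hf_l := fLam_antitone (Set.mem_Ici.2 hl1) (Set.mem_Ici.2 (le_trans hl1 hlam_ge)) hlam_ge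
  have hf_m := fLam_antitone (Set.mem_Ici.2 (le_trans hl1 hlam_ge))
    (Set.mem_Ici.2 (le_trans (le_trans hl1 hlam_ge) hlam_le)) hlam_le
  simp only at hf_l hf_m
  unfold rbVal
  dsimp only
  split_ifs with hk
  · -- k ≥ 0
    have hk' : (0 : ℝ) ≤ k := by exact_mod_cast hk
    have t2 : 7 / 8 * (N * edgeU a b N) * edgeU a b N
        ≤ 7 / 8 * (((b : ℝ) - a) * Ntop / ((Ntop : ℝ) - b)) * (((b : ℝ) - a) / ((Ntop : ℝ) - b)) := by
      have := mul_le_mul hlam_le hu_max hu0.le hlamMax0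
      linarith
    have p2 := pow_le_pow_left₀ hu0.le hu_max 2
    have p3 := pow_le_pow_left₀ hu0.le hu_max 3
    have hcu : edgeU a b N ^ 2 * (1 / 288 + 3 * edgeU a b N / 128 + edgeU a b N ^ 2 / 64000
          + 17 * edgeU a b N ^ 3 / 72000)
        ≤ (((b : ℝ) - a) / ((Ntop : ℝ) - b)) ^ 2 * (1 / 288 + 3 * (((b : ℝ) - a) / ((Ntop : ℝ) - b)) / 128
          + (((b : ℝ) - a) / ((Ntop : ℝ) - b)) ^ 2 / 64000 + 17 * (((b : ℝ) - a) / ((Ntop : ℝ) - b)) ^ 3 / 72000) := by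
      apply mul_le_mul p2 _ (by positivity) (by positivity)
      linarith
    have t3 : N * (zetaScrew (edgeU a b N) - zetaScrewMain (edgeU a b N))
        ≤ (((b : ℝ) - a) * Ntop / ((Ntop : ℝ) - b)) * ((((b : ℝ) - a) / ((Ntop : ℝ) - b)) ^ 2
          * (1 / 288 + 3 * (((b : ℝ) - a) / ((Ntop : ℝ) - b)) / 128
            + (((b : ℝ) - a) / ((Ntop : ℝ) - b)) ^ 2 / 64000 + 17 * (((b : ℝ) - a) / ((Ntop : ℝ) - b)) ^ 3 / 72000)) := by
      have h1 : N * (zetaScrew (edgeU a b N) - zetaScrewMain (edgeU a b N))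
          ≤ (N * edgeU a b N) * (edgeU a b N ^ 2 * (1 / 288 + 3 * edgeU a b N / 128
            + edgeU a b N ^ 2 / 64000 + 17 * edgeU a b N ^ 3 / 72000)) := by
        have := mul_le_mul_of_nonneg_left rhi hNpos.le
        have e : N * (edgeU a b N ^ 3 / 288 + 3 / 128 * edgeU a b N ^ 4 + edgeU a b N ^ 5 / 64000
            + 17 / 72000 * edgeU a b N ^ 6)
            = (N * edgeU a b N) * (edgeU a b N ^ 2 * (1 / 288 + 3 * edgeU a b N / 128
              + edgeU a b N ^ 2 / 64000 + 17 * edgeU a b N ^ 3 / 72000)) := by ring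
        linarith
      have h2 := mul_le_mul hlam_le hcu (by positivity) hlamMax0
      linarith
    have hsum : edgeH a b N ≤ Real.log N / 2 * (N * edgeU a b N)
        + ((((b : ℝ) - a) * zetaScrewSlope - Real.log ((b : ℝ) - a) * ((b : ℝ) - a) / 2)
        + (7 / 8 * (((b : ℝ) - a) * Ntop / ((Ntop : ℝ) - b)) * (((b : ℝ) - a) / ((Ntop : ℝ) - b))
          + (((b : ℝ) - a) * Ntop / ((Ntop : ℝ) - b)) * (((b : ℝ) - a) / ((Ntop : ℝ) - b)) ^ 2
          * (1 / 288 + 3 * (((b : ℝ) - a) / ((Ntop : ℝ) - b)) / 128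
            + (((b : ℝ) - a) / ((Ntop : ℝ) - b)) ^ 2 / 64000 + 17 * (((b : ℝ) - a) / ((Ntop : ℝ) - b)) ^ 3 / 72000))) := by
      rw [hedge, hmain]
      have e : Real.log ((b : ℝ) - a) * ((b : ℝ) - a) / 2 = ((b : ℝ) - a) * Real.log ((b : ℝ) - a) / 2 := by ring
      rw [e]
      nlinarith [hf_l, t2, t3]
    have := mul_le_mul_of_nonneg_left hsum hk'
    refine le_trans this (le_of_eq ?_)
    ring
  · -- k < 0
    push Not at hk
    have hk' : (k : ℝ) ≤ 0 := by exact_mod_cast hk.le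
    have t2 : 0 ≤ 7 / 8 * (N * edgeU a b N) * edgeU a b N := by positivity
    have t3 : 0 ≤ N * (zetaScrew (edgeU a b N) - zetaScrewMain (edgeU a b N)) :=
      mul_nonneg hNpos.le (le_trans (RL_nonneg hu0.le hu_half) rlo)
    have hsum : Real.log N / 2 * (N * edgeU a b N)
        + ((((b : ℝ) - a) * Ntop / ((Ntop : ℝ) - b)) * zetaScrewSlope
          - Real.log (((b : ℝ) - a) * Ntop / ((Ntop : ℝ) - b)) * (((b : ℝ) - a) * Ntop / ((Ntop : ℝ) - b)) / 2)
        ≤ edgeH a b N := by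
      rw [hedge, hmain]
      have e : Real.log (((b : ℝ) - a) * Ntop / ((Ntop : ℝ) - b)) * (((b : ℝ) - a) * Ntop / ((Ntop : ℝ) - b)) / 2
          = (((b : ℝ) - a) * Ntop / ((Ntop : ℝ) - b)) * Real.log (((b : ℝ) - a) * Ntop / ((Ntop : ℝ) - b)) / 2 := by
        ring
      rw [e]
      linarith [hf_m, t2, t3]
    have := mul_le_mul_of_nonpos_left hsum hk'
    refine le_trans this (le_of_eq ?_)
    ring

/-- Real value `s1Val` bounding `k λ_e(N)` from above for `N ≥ N_top`. [folklore] -/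
noncomputable def s1Val (a b : ℕ) (k : ℤ) (Ntop : ℕ) : ℝ :=
  if 0 ≤ k then (k : ℝ) * (((b : ℝ) - a) * Ntop / ((Ntop : ℝ) - b)) else (k : ℝ) * ((b : ℝ) - a)

/-- `k·λ_e(N) ≤ s1Val` for `N ≥ N_top`. [folklore] -/
theorem s1Val_ge {a b : ℕ} (k : ℤ) {Ntop : ℕ} (hab : a < b) (hb15 : b ≤ 15) (hNt : 128 ≤ Ntop)
    {N : ℝ} (hN : (Ntop : ℝ) ≤ N) : (k : ℝ) * (N * edgeU a b N) ≤ s1Val a b k Ntop := by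
  have hab' : (a : ℝ) < b := by exact_mod_cast hab
  have hb15' : (b : ℝ) ≤ 15 := by exact_mod_cast hb15
  have hNt' : (128 : ℝ) ≤ Ntop := by exact_mod_cast hNt
  have ha0 : (0 : ℝ) ≤ a := Nat.cast_nonneg a
  have hb0 : (0 : ℝ) ≤ b := Nat.cast_nonneg b
  have hNpos : 0 < N := by linarith
  have hbN : (b : ℝ) < N := by linarith
  obtain ⟨hu0, _⟩ := edgeU_pos_lt hab (N := N) (by linarith)
  obtain ⟨ulo, uhi⟩ := edgeU_bounds hab hbN
  have hNb : 0 < N - b := by linarith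
  have hNtb : (0 : ℝ) < (Ntop : ℝ) - b := by linarith
  unfold s1Val
  split_ifs with hk
  · have hk' : (0 : ℝ) ≤ k := by exact_mod_cast hk
    apply mul_le_mul_of_nonneg_left _ hk'
    have h1 : N * edgeU a b N ≤ N * (((b : ℝ) - a) / (N - b)) := mul_le_mul_of_nonneg_left uhi hNpos.le
    have hkey : 0 ≤ ((b : ℝ) - a) * b * (N - Ntop) := mul_nonneg (mul_nonneg (by linarith) hb0) (by linarith)
    have h2 : N * (((b : ℝ) - a) / (N - b)) ≤ ((b : ℝ) - a) * Ntop / ((Ntop : ℝ) - b) := by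
      rw [mul_div_assoc', div_le_div_iff₀ hNb hNtb]; nlinarith
    linarith
  · push Not at hk
    have hk' : (k : ℝ) ≤ 0 := by exact_mod_cast hk.le
    apply mul_le_mul_of_nonpos_left _ hk'
    have h1 : ((b : ℝ) - a) ≤ N * (((b : ℝ) - a) / (N - a)) := by
      rw [mul_div_assoc', le_div_iff₀ (by linarith)]; nlinarith
    exact le_trans h1 (mul_le_mul_of_nonneg_left ulo hNpos.le)

/-- Sum of `rbVal` over the edge list. [folklore] -/
noncomputable def rbSum (Ntop : ℕ) : List (ℕ × ℕ × ℤ) → ℝ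
  | [] => 0
  | (a, b, k) :: rest => rbVal a b k Ntop + rbSum Ntop rest

/-- List-level bounds for the last cell. [folklore] -/
theorem last_aux {B : FI} {Ntop : ℕ} (hB : FI.mem zetaScrewSlope B) (hNt : 128 ≤ Ntop) {N : ℝ}
    (hN : (Ntop : ℝ) ≤ N) :
    ∀ (E : List (ℕ × ℕ × ℤ)), (∀ t ∈ E, t.1 < t.2.1 ∧ t.2.1 ≤ 15) →
      dsum edgeH E N ≤ Real.log N / 2 * dsum (fun a b N => N * edgeU a b N) E N + rbSum Ntop E ∧
      FI.mem (rbSum Ntop E) (lastRBSum B Ntop E) ∧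
      dsum (fun a b N => N * edgeU a b N) E N ≤ (s1Hi Ntop E : ℝ)
  | [], _ => by
      simp only [dsum, List.map_nil, List.sum_nil, rbSum, lastRBSum, s1Hi, mul_zero, zero_add, Rat.cast_zero]
      exact ⟨le_refl _, FI.mem_zero, le_refl _⟩
  | (a, b, k) :: rest, hE => by
      have hab := hE (a, b, k) (by simp)
      simp only at hab
      obtain ⟨r1, r2, r3⟩ := last_aux hB hNt hN rest (fun t ht => hE t (by simp [ht]))
      have e1 := lastEdge_le k hab.1 hab.2 hNt hN
      have e3 := s1Val_ge k hab.1 hab.2 hNt hN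
      have hLl : FI.mem (Real.log ((b : ℝ) - a)) (RungCert.lg (FI.logTable 16) (b - a)) := by
        have hok : FI.logTableOK 16 = true := by decide
        have := FI.mem_logTable hok (n := b - a) (by omega)
        unfold RungCert.lg
        convert this using 2; push_cast [Nat.cast_sub hab.1.le]; ring
      have e2 := mem_lastEdgeRB (k := k) hB hLl hab.1 (by omega : b < Ntop)
      refine ⟨?_, ?_, ?_⟩
      · rw [dsum_cons, dsum_cons]
        simp only [rbSum]
        nlinarith [e1, r1]
      · simp only [rbSum, lastRBSum]
        exact FI.mem_add e2 r2
      · rw [dsum_cons]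
        simp only [s1Hi]
        push_cast
        have : s1Val a b k Ntop = ((if 0 ≤ k then (k : ℚ) * (((b : ℚ) - a) * Ntop / ((Ntop : ℚ) - b))
            else (k : ℚ) * ((b : ℚ) - a) : ℚ) : ℝ) := by
          unfold s1Val; split_ifs <;> push_cast <;> ring
        rw [← this]
        linarith

/-- Soundness of `lastCheckWith`. [folklore] -/
theorem lastCheckWith_sound {E : List (ℕ × ℕ × ℤ)} (hE : ∀ t ∈ E, t.1 < t.2.1 ∧ t.2.1 ≤ 15)
    {B logNt : FI} {Ntop : ℕ} (hB : FI.mem zetaScrewSlope B) (hlog : FI.mem (Real.log Ntop) logNt)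
    (h : lastCheckWith B logNt E Ntop = true) {N : ℝ} (hN : (Ntop : ℝ) ≤ N) : dsum edgeH E N < 0 := by
  unfold lastCheckWith at h
  dsimp only at h
  simp only [Bool.and_eq_true, decide_eq_true_eq] at h
  obtain ⟨⟨hS, hNt⟩, hlt⟩ := h
  obtain ⟨r1, r2, r3⟩ := last_aux hB hNt hN E hE
  have hNt' : (128 : ℝ) ≤ Ntop := by exact_mod_cast hNt
  have hNpos : (0 : ℝ) < N := by linarith
  have hlogN : Real.log Ntop ≤ Real.log N := Real.log_le_log (by linarith) hN
  have hlogNt0 : 0 ≤ Real.log (Ntop : ℝ) := Real.log_nonneg (by linarith)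
  have hS' : ((s1Hi Ntop E : ℚ) : ℝ) < 0 := by exact_mod_cast hS
  -- (log N)/2 · S1(N) ≤ (log Ntop)/2 · s1Hi
  have step1 : Real.log N / 2 * dsum (fun a b N => N * edgeU a b N) E N ≤ Real.log N / 2 * (s1Hi Ntop E : ℝ) :=
    mul_le_mul_of_nonneg_left r3 (by linarith)
  have step2 : Real.log N / 2 * (s1Hi Ntop E : ℝ) ≤ Real.log Ntop / 2 * (s1Hi Ntop E : ℝ) := by
    nlinarith
  have hm : FI.mem (Real.log Ntop / 2 * (s1Hi Ntop E : ℝ) + rbSum Ntop E)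
      (((logNt.mul (FI.ofRat (s1Hi Ntop E))).divNat 2).add (lastRBSum B Ntop E)) := by
    have := FI.mem_add (FI.mem_divNat (FI.mem_mul hlog (FI.mem_ofRat (s1Hi Ntop E))) (n := 2) (by norm_num)) r2
    convert this using 1; ring
  have htop := FI.le_hiQ hm
  have hlt' : ((FI.hiQ (((logNt.mul (FI.ofRat (s1Hi Ntop E))).divNat 2).add (lastRBSum B Ntop E)) : ℚ) : ℝ) < 0 := by
    exact_mod_cast hlt
  linarith

/-- **Soundness of the last-cell test**: `lastCheck E N_top = true` implies `D(N) < 0` for every real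
`N ≥ N_top`. [folklore] -/
theorem lastCheck_sound {E : List (ℕ × ℕ × ℤ)} (hE : ∀ t ∈ E, t.1 < t.2.1 ∧ t.2.1 ≤ 15) {Ntop : ℕ}
    (h : lastCheck E Ntop = true) {N : ℝ} (hN : (Ntop : ℝ) ≤ N) : dsum edgeH E N < 0 := by
  unfold lastCheck at h
  generalize hb : betaFI = ob at h
  generalize hl : logNat Ntop = ol at h
  rcases ob with _ | B
  · exact (Bool.false_ne_true h).elim
  rcases ol with _ | L
  · exact (Bool.false_ne_true h).elim
  have h' : lastCheckWith B L E Ntop = true := h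
  exact lastCheckWith_sound hE (mem_betaFI hb) (mem_logNat hl).2 h' hN

open Literature.Analysis.ValidatedNumerics Literature.Analysis.ValidatedNumerics.Numerics
open Summit.RiemannHypothesis.RiemannHypothesis.Theorems.IntegerScrew
open Literature.NumberTheory.LFunctions Finset
open Summit.RiemannHypothesis.RiemannHypothesis.Theorems.IntegerScrew.Manifest

/-! ### Assembly: cells + last cell ⇒ the whole tail -/

/-- Cells that pass cover `[r, reach cells r]`. [folklore] -/
theorem cells_sound {E : List (ℕ × ℕ × ℤ)} (hE : ∀ t ∈ E, t.1 < t.2.1 ∧ t.2.1 ≤ 15) :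
    ∀ (cells : List (ℕ × ℕ × ℕ)) (r : ℕ), cellsCheck E cells = true →
      ∀ {N : ℝ}, (r : ℝ) ≤ N → N ≤ (reach cells r : ℝ) → dsum edgeH E N < 0 ∨ N = r
  | [], r, _, N, h1, h2 => by
      right; simp only [reach] at h2; linarith
  | (N1, Nc, N2) :: rest, r, hc, N, h1, h2 => by
      simp only [cellsCheck, List.all_cons, Bool.and_eq_true] at hc
      obtain ⟨hcell, hrest⟩ := hc
      simp only [reach] at h2
      split_ifs at h2 with hle
      · -- this cell starts at or before r
        by_cases hN2 : N ≤ (N2 : ℝ)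
        · left
          exact cellCheck_sound hE hcell (le_trans (by exact_mod_cast hle) h1) hN2
        · push Not at hN2
          have hmax : ((max r N2 : ℕ) : ℝ) ≤ N := by
            rw [Nat.cast_max]; exact max_le h1 hN2.le
          rcases cells_sound hE rest (max r N2) (by simpa [cellsCheck] using hrest) hmax h2 with h | h
          · left; exact h
          · -- N = max r N2 ≥ N2 and N > N2 contradiction unless r > N2; then N = r
            rw [Nat.cast_max] at h
            rcases le_total (r : ℝ) (N2 : ℝ) with hr | hr
            · rw [max_eq_right hr] at h; linarith
            · right; rw [max_eq_left hr] at h; exact h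
      · right; linarith

/-- **The tail theorem (real form).**  If the cells pass, the chain from `128` reaches `N_top`, and the
last-cell test passes at `N_top`, then `D(N) < 0` for every real `N > 128`. [folklore] -/
theorem tail_neg_real {E : List (ℕ × ℕ × ℤ)} (hE : ∀ t ∈ E, t.1 < t.2.1 ∧ t.2.1 ≤ 15)
    {cells : List (ℕ × ℕ × ℕ)} {Ntop : ℕ} (hcells : cellsCheck E cells = true)
    (hreach : Ntop ≤ reach cells 128) (hlast : lastCheck E Ntop = true)
    {N : ℝ} (hN : (128 : ℝ) < N) : dsum edgeH E N < 0 := by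
  by_cases hbig : (Ntop : ℝ) ≤ N
  · exact lastCheck_sound hE hlast hbig
  · push Not at hbig
    have hreach' : N ≤ (reach cells 128 : ℝ) := le_trans hbig.le (by exact_mod_cast hreach)
    rcases cells_sound hE cells 128 hcells (by push_cast; linarith) hreach' with h | h
    · exact h
    · push_cast at h; linarith

/-- `D(N) = N · Σ_e k_e Ψ(u_e(N))`. [folklore] -/
theorem dsum_edgeH_eq (N : ℝ) :
    ∀ L : List (ℕ × ℕ × ℤ),
      dsum edgeH L N = N * (L.map fun t => (t.2.2 : ℝ) * zetaScrew (edgeU t.1 t.2.1 N)).sum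
  | [] => by simp [dsum]
  | t :: L => by
      rw [dsum_cons, dsum_edgeH_eq N L]
      simp only [List.map_cons, List.sum_cons, edgeH]
      ring

/-- **The tail theorem (integer form)**: under the three certificate hypotheses,
`Σ_e k_e Ψ(log(N − a_e) − log(N − b_e)) < 0` for every integer `N ≥ 129`. [folklore] -/
theorem topPairingSum_neg_of_ge_129 {cells : List (ℕ × ℕ × ℕ)} {Ntop : ℕ}
    (hcells : cellsCheck d16 cells = true) (hreach : Ntop ≤ reach cells 128)
    (hlast : lastCheck d16 Ntop = true) {N : ℕ} (hN : 129 ≤ N) :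
    (d16.map fun t => (t.2.2 : ℝ) * zetaScrew (Real.log ((N : ℝ) - t.1) - Real.log ((N : ℝ) - t.2.1))).sum < 0 := by
  have hNr : (128 : ℝ) < N := by exact_mod_cast (show 128 < N by omega)
  have h := tail_neg_real d16_shape hcells hreach hlast hNr
  rw [dsum_edgeH_eq] at h
  have hNpos : (0 : ℝ) < N := by linarith
  have := (mul_neg_iff.1 h)
  rcases this with ⟨_, hneg⟩ | ⟨hle, _⟩
  · simpa [edgeU] using hneg
  · linarith

/-- Concatenation of passing cell lists passes. [folklore] -/
theorem cellsCheck_append {E : List (ℕ × ℕ × ℤ)} {c1 c2 : List (ℕ × ℕ × ℕ)}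
    (h1 : cellsCheck E c1 = true) (h2 : cellsCheck E c2 = true) : cellsCheck E (c1 ++ c2) = true := by
  simp only [cellsCheck, List.all_append, Bool.and_eq_true] at *
  exact ⟨h1, h2⟩

/-- The whole schedule passes. [folklore] -/
theorem tailCells_pass : cellsCheck d16 tailCells = true := by
  have := cellsCheck_append tailCellsA_pass tailCellsB_pass
  simpa [tailCellsA, tailCellsB] using this

/-- **The tail theorem**: `Σ_e k_e Ψ(log(N − a_e) − log(N − b_e)) < 0` for every integer `N ≥ 129`
(the D16 top-block pairing; kernel-certified cells `128 → 20395` and the sign argument beyond). [folklore] -/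
theorem topPairingSum_neg_129 {N : ℕ} (hN : 129 ≤ N) :
    (d16.map fun t => (t.2.2 : ℝ) * zetaScrew (Real.log ((N : ℝ) - t.1) - Real.log ((N : ℝ) - t.2.1))).sum < 0 :=
  topPairingSum_neg_of_ge_129 tailCells_pass tailCells_reach tailLast_pass hN

/-! ### Head + tail, and sos-theory's `Fin 110` form -/

/-- `G_N = topPairing N < 0` for every integer `N ≥ 31` (design `D16`). [folklore] -/
theorem topPairing_neg {N : ℕ} (h31 : 31 ≤ N) : topPairing N < 0 := by
  by_cases h128 : N ≤ 128
  · exact topPairing_neg_of_le_128 h31 h128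
  · have h129 : 129 ≤ N := by omega
    unfold topPairing
    exact topPairingSum_neg_129 h129

/-- The design literal of the tail checker is sos-theory's `(tbA, tbB, tbK)`. [folklore] -/
theorem d16_eq_ofFn : d16 = List.ofFn (fun e : Fin tbE => (tbA e, tbB e, tbK e)) := by
  set_option maxRecDepth 100000 in decide

/-- sos-theory's `Fin 110` pairing equals `topPairing`. [folklore] -/
theorem sum_tbC_zetaScrew_tbD_eq (N : ℕ) : ∑ e, tbC e * zetaScrew (tbD N e) = topPairing N := by
  unfold topPairing
  rw [d16_eq_ofFn, List.map_ofFn, List.sum_ofFn]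
  rfl

/-- **`TopBlockPairingNeg 31`** (sos-theory's RH-free numerical input NEG of `TopBlockD16Works`), kernel-proved:
`Σ_e tbC e · Ψ(tbD N e) < 0` for every `N ≥ 31`. [folklore] -/
theorem topBlockPairingNeg_31 : TopBlockPairingNeg 31 := by
  intro N hN
  rw [sum_tbC_zetaScrew_tbD_eq]
  exact topPairing_neg hN

/-- **CLOSER of crux `stmt-RiemannHypothesis-20030`** (route `ScrewNyquistFloor`, decl `TopBlockNeg31`, P-NEG):
`∀ N ≥ 31, Σ_e tbC e · Ψ(tbD N e) < 0` — literally `TopBlockPairingNeg 31`. [folklore] -/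
theorem topBlockNeg31 :
    Summit.RiemannHypothesis.RiemannHypothesis.Theses.ScrewNyquistFloor.TopBlockNeg31 :=
  fun N hN => topBlockPairingNeg_31 N hN

end Summit.RiemannHypothesis.RiemannHypothesis.Theorems.IntegerScrew.TopBlockNeg

end

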